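import Summits.QuantumAdvantage.QuantumAdvantage.Theorems.CharDialPartyDialI4

/-!
# PartyDial (decomp-qadv lens-5 g35), part I5 — §8f (second half): the conditioned count `multi_cond` and ★★★ `multi_law_core` (any finite set W of dense cuts outside a free window, GIVEN LowDegIndep3At at degree |W|·3^k·D ⟹ ≤ (1 − 4^{-(k+1)})·2ⁿ)

See part A (`CharDialPartyDialA`) for the node header; memo `NODE-g35.md` (g35 folder of decomp-qadv-lens-5).
-/

set_option autoImplicit false
set_option linter.dupNamespace false

namespace Summit.QuantumAdvantage.QuantumAdvantage.Theorems.PartyDial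

open Finset
open Summit.QuantumAdvantage.AdviceFreeQNC0

section MultiDense

open Literature.Computability.MetaComplexity

variable {n k : ℕ} {lo hi : Fin k → ℕ}

/-- **the conditioned count**: under one conditioning `a` of the free coordinates outside the gap, at least
`2ⁿ/4/2^{#gapFᶜ}` losers agree with `a` there. -/
theorem multi_cond (hP : PairsOK lo hi) (hlt : ∀ j, lo j < n ∧ hi j < n) (c : ℕ)
    (y : Fin (n + 1) → (Fin n → Bool) → Bool) (W : Finset (Fin (n + 1))) {G₁ G₂ : ℕ}
    (hW : ∀ g ∈ W, g.val ≤ G₁ ∨ G₂ ≤ g.val)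
    (hbl : ∀ g : Fin (n + 1), g ∉ W → ∃ j : Fin k, (lo j < g.val ↔ hi j < g.val) ∧
      ∀ u v : Fin n → Bool, (∀ i : Fin n, i.val ≠ lo j → i.val ≠ hi j → u i = v i) → y g u = y g v)
    {p : ℕ} [Fact p.Prime] {D m₀ : ℕ} (hdeg : ∀ g ∈ W, HasDegF p (y g) D)
    (hF : LowDegIndep3At p (W.card * 3 ^ k * D) (1 / (12 * 2 ^ (W.card * 3 ^ k))) m₀)
    (hm : m₀ ≤ (gapF lo hi G₁ G₂ (n := n)).card) (a : Fin n → Bool) :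
    (2 : ℝ) ^ n / 4 / (2 : ℝ) ^ ((gapF lo hi G₁ G₂ (n := n))ᶜ.card) ≤
      ((univ.filter fun u : Fin n → Bool => ringWinU c y u = false ∧
        ∀ i ∈ gapX lo hi G₁ G₂ (n := n), u i = a i).card : ℝ) := by
  classical
  set X := gapX lo hi G₁ G₂ (n := n) with hXdef
  set Fg := gapF lo hi G₁ G₂ (n := n) with hFdef
  -- pattern tuple, pair parts, coefficients
  set Φ : (Fin n → Bool) → (↥W × (Fin k → Fin 3)) → Bool :=
    fun t q => y q.1.1 (fill lo hi (ovr X a t) q.2) with hΦ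
  set s : Fin (n + 1) → (Fin k → Fin 3) → ℕ := fun g z => c + g.val + RW lo hi G₁ G₂ a z g.val (n := n) with hs
  set cw : Fin (n + 1) → ℕ := fun g => cW G₁ g.val with hcw
  have hN : ∀ t, ∀ g ∈ W, (univ.filter fun z : Fin k → Fin 3 => y g (fill lo hi (ovr X a t) z) = true ∧
      (c + g.val + walkExp (fill lo hi (ovr X a t) z) g.val) % 3 ≠ 0) =
      univ.filter fun z : Fin k → Fin 3 => y g (fill lo hi (ovr X a t) z) = true ∧
        (cw g * sig lo hi G₁ G₂ t + s g z) % 3 ≠ 0 := by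
    intro t g hg
    refine Finset.filter_congr fun z _ => ?_
    rw [walkExp_cond a t z (hW g hg), hs, hcw]
    simp only
    rw [show c + g.val + (cW G₁ g.val * sig lo hi G₁ G₂ t + RW lo hi G₁ G₂ a z g.val) =
      cW G₁ g.val * sig lo hi G₁ G₂ t + (c + g.val + RW lo hi G₁ G₂ a z g.val) by ring]
  -- one even residue per pattern tuple
  choose r hr using fun φ : (↥W × (Fin k → Fin 3)) → Bool =>
    exists_even_residue_multi W (fun g z => if hg : g ∈ W then φ (⟨g, hg⟩, z) else false) s cw
      fun g _ => cW_cases G₁ g.val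
  set Gφ : ((↥W × (Fin k → Fin 3)) → Bool) → Finset (Fin n → Bool) := fun φ =>
    univ.filter fun t => decide (∀ q, Φ t q = φ q) = true ∧ (0 + sig lo hi G₁ G₂ t) % 3 = (r φ).val % 3 with hGφ
  set G : Finset (Fin n → Bool) := univ.filter fun t =>
    ∃ z : Fin k → Fin 3, ringWinU c y (fill lo hi (ovr X a t) z) = false with hG
  -- (1) every good assignment has a grid loser
  have hGφ_sub : ∀ φ, Gφ φ ⊆ G := by
    intro φ t ht
    rw [hGφ, mem_filter] at ht
    obtain ⟨_, hpat, hres⟩ := ht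
    have hpat' : ∀ q, Φ t q = φ q := of_decide_eq_true hpat
    rw [zero_add] at hres
    rw [hG, mem_filter]
    refine ⟨mem_univ _, grid_loser_multi hP hlt (ovr X a t) c y W hbl ?_⟩
    rw [Finset.sum_congr rfl fun g hg => by rw [hN t g hg]]
    have heq : (∑ g ∈ W, (univ.filter fun z : Fin k → Fin 3 => y g (fill lo hi (ovr X a t) z) = true ∧
        (cw g * sig lo hi G₁ G₂ t + s g z) % 3 ≠ 0).card) =
        ∑ g ∈ W, (univ.filter fun z : Fin k → Fin 3 =>
          (if hg : g ∈ W then φ (⟨g, hg⟩, z) else false) = true ∧ (cw g * (r φ).val + s g z) % 3 ≠ 0).card := by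
      refine Finset.sum_congr rfl fun g hg => congrArg Finset.card (Finset.filter_congr fun z _ => ?_)
      have hmod : (cw g * sig lo hi G₁ G₂ t + s g z) % 3 = (cw g * (r φ).val + s g z) % 3 := by
        rw [Nat.add_mod, Nat.mul_mod, hres, ← Nat.mul_mod, ← Nat.add_mod]
      rw [dif_pos hg, ← hpat' (⟨g, hg⟩, z), hmod]
    rw [heq]
    exact hr φ
  -- (2) the good assignments are many
  have hdisj : ∀ φ ∈ (univ : Finset ((↥W × (Fin k → Fin 3)) → Bool)),
      ∀ φ' ∈ (univ : Finset ((↥W × (Fin k → Fin 3)) → Bool)), φ ≠ φ' → Disjoint (Gφ φ) (Gφ φ') := by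
    intro φ _ φ' _ hne
    rw [Finset.disjoint_left]
    intro t ht ht'
    rw [hGφ, mem_filter] at ht ht'
    have h1 : ∀ q, Φ t q = φ q := of_decide_eq_true ht.2.1
    have h2 : ∀ q, Φ t q = φ' q := of_decide_eq_true ht'.2.1
    exact hne (funext fun q => (h1 q).symm.trans (h2 q))
  have hw : m₀ ≤ (univ.filter fun i : Fin n =>
      (if i ∈ gapF lo hi G₁ G₂ (n := n) then 1 else 0) % 3 ≠ 0).card := by
    rw [card_weights_gap]; exact hm
  have hcardι : Fintype.card (↥W × (Fin k → Fin 3)) = W.card * 3 ^ k := by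
    rw [Fintype.card_prod, Fintype.card_coe, Fintype.card_fun, Fintype.card_fin, Fintype.card_fin]
  have hFφ : ∀ φ, ((univ.filter fun t : Fin n → Bool => decide (∀ q, Φ t q = φ q) = true).card : ℝ) / 3 -
      1 / (12 * 2 ^ (W.card * 3 ^ k)) * (2 : ℝ) ^ n ≤ ((Gφ φ).card : ℝ) := by
    intro φ
    have hdegφ : HasDegF p (fun t => decide (∀ q, Φ t q = φ q)) (W.card * 3 ^ k * D) := by
      have h := hasDegF_pattern (fun (q : ↥W × (Fin k → Fin 3)) (t : Fin n → Bool) => Φ t q)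
        (fun q => hasDegF_ovr (hasDegF_fill (lo := lo) (hi := hi) (hdeg q.1.1 q.1.2) q.2) X a) φ
      rwa [hcardι] at h
    have h := hF n _ hdegφ _ hw 0 (r φ).val
    have hset : (univ.filter fun t : Fin n → Bool => decide (∀ q, Φ t q = φ q) = true ∧
        (0 + linW (fun i : Fin n => if i ∈ gapF lo hi G₁ G₂ (n := n) then 1 else 0) t) % 3 = (r φ).val % 3) =
        Gφ φ := by
      rw [hGφ]
      refine Finset.filter_congr fun t _ => ?_
      rw [sig_eq_linW]
    rw [hset] at h
    exact h
  have hpart : ∑ φ : (↥W × (Fin k → Fin 3)) → Bool,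
      ((univ.filter fun t : Fin n → Bool => decide (∀ q, Φ t q = φ q) = true).card : ℝ) = (2 : ℝ) ^ n := by
    have h := Finset.card_eq_sum_card_fiberwise (s := (univ : Finset (Fin n → Bool)))
      (t := (univ : Finset ((↥W × (Fin k → Fin 3)) → Bool))) (f := fun t => Φ t) fun _ _ => mem_univ _
    rw [Finset.card_univ, Fintype.card_fun, Fintype.card_bool, Fintype.card_fin] at h
    have h' : ((2 : ℕ) ^ n : ℝ) = ∑ φ : (↥W × (Fin k → Fin 3)) → Bool,
        ((univ.filter fun t : Fin n → Bool => Φ t = φ).card : ℝ) := by exact_mod_cast h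
    push_cast at h'
    rw [h']
    refine Finset.sum_congr rfl fun φ _ => ?_
    congr 2
    ext t
    simp only [mem_filter, mem_univ, true_and, decide_eq_true_eq]
    exact funext_iff.symm
  have hnumφ : (Fintype.card ((↥W × (Fin k → Fin 3)) → Bool) : ℝ) = (2 : ℝ) ^ (W.card * 3 ^ k) := by
    rw [Fintype.card_fun, Fintype.card_bool, hcardι]
    push_cast
    ring
  have hGcard : (2 : ℝ) ^ n / 4 ≤ (G.card : ℝ) := by
    have hU : ((univ : Finset ((↥W × (Fin k → Fin 3)) → Bool)).biUnion Gφ).card ≤ G.card :=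
      card_le_card (Finset.biUnion_subset.2 fun φ _ => hGφ_sub φ)
    rw [Finset.card_biUnion hdisj] at hU
    have hU' : (∑ φ : (↥W × (Fin k → Fin 3)) → Bool, ((Gφ φ).card : ℝ)) ≤ (G.card : ℝ) := by
      exact_mod_cast hU
    have hsum : ∑ φ : (↥W × (Fin k → Fin 3)) → Bool,
        (((univ.filter fun t : Fin n → Bool => decide (∀ q, Φ t q = φ q) = true).card : ℝ) / 3 -
          1 / (12 * 2 ^ (W.card * 3 ^ k)) * (2 : ℝ) ^ n) ≤
        ∑ φ : (↥W × (Fin k → Fin 3)) → Bool, ((Gφ φ).card : ℝ) :=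
      Finset.sum_le_sum fun φ _ => hFφ φ
    rw [Finset.sum_sub_distrib, ← Finset.sum_div, hpart, Finset.sum_const, Finset.card_univ, nsmul_eq_mul,
      hnumφ] at hsum
    have hpos : (0 : ℝ) < (2 : ℝ) ^ (W.card * 3 ^ k) := by positivity
    have he : (2 : ℝ) ^ (W.card * 3 ^ k) * (1 / (12 * 2 ^ (W.card * 3 ^ k)) * (2 : ℝ) ^ n) = (2 : ℝ) ^ n / 12 := by
      field_simp
    rw [he] at hsum
    linarith
  -- (3) each loser arises from at most `2^{#gapFᶜ}` good assignments, and agrees with `a` on `X`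
  choose zl hzl using fun t : ↥G => (mem_filter.1 t.2).2
  set f : (Fin n → Bool) → (Fin n → Bool) := fun t =>
    if ht : t ∈ G then fill lo hi (ovr X a t) (zl ⟨t, ht⟩) else t with hf
  have hfib : ∀ u ∈ G.image f, (G.filter fun t => f t = u).card ≤ 2 ^ (Fgᶜ.card) := by
    intro u _
    calc (G.filter fun t => f t = u).card
        ≤ (univ.filter fun t : Fin n → Bool => ∀ i ∈ Fg, t i = u i).card := by
          refine card_le_card fun t ht => ?_
          rw [mem_filter] at ht
          obtain ⟨htG, htu⟩ := ht
          refine mem_filter.2 ⟨mem_univ _, fun i hi0 => ?_⟩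
          rw [← htu, hf]
          simp only [htG, dif_pos]
          rw [fill_ovr_gap a t _ i hi0]
      _ ≤ 2 ^ (Fgᶜ.card) := card_agree_le _ u
  have himg : G.image f ⊆ univ.filter fun u : Fin n → Bool => ringWinU c y u = false ∧
      ∀ i ∈ X, u i = a i := by
    intro u hu
    rw [mem_image] at hu
    obtain ⟨t, ht, rfl⟩ := hu
    refine mem_filter.2 ⟨mem_univ _, ?_, fun i hi0 => ?_⟩
    · rw [hf]
      simp only [ht, dif_pos]
      exact hzl ⟨t, ht⟩
    · rw [hf]
      simp only [ht, dif_pos]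
      have hi1 : i ∉ Fg := fun h => (mem_filter.1 hi0).2 (mem_filter.1 h).2
      rw [fill_ovr_off a t _ i hi1]
      unfold baseU
      rw [fill_free _ _ i (mem_filter.1 (mem_filter.1 hi0).1).2]
      have hi0' : i ∈ gapX lo hi G₁ G₂ (n := n) := hi0
      simp [ovr, hi0']
  have hGle : G.card ≤ 2 ^ (Fgᶜ.card) * (univ.filter fun u : Fin n → Bool => ringWinU c y u = false ∧
      ∀ i ∈ X, u i = a i).card :=
    (Finset.card_le_mul_card_image G _ hfib).trans (Nat.mul_le_mul_left _ (card_le_card himg))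
  have hGle' : (G.card : ℝ) ≤ (2 : ℝ) ^ (Fgᶜ.card) * ((univ.filter fun u : Fin n → Bool =>
      ringWinU c y u = false ∧ ∀ i ∈ X, u i = a i).card : ℝ) := by exact_mod_cast hGle
  have h2pos : (0 : ℝ) < (2 : ℝ) ^ (Fgᶜ.card) := by positivity
  rw [div_le_iff₀ h2pos]
  linarith

/-- ★★★ **MULTI-DENSE LAW (core)**: `k` disjoint pairs; every cut outside a finite set `W` blind to and
non-splitting for one of them; every cut of `W` of `𝔽_p`-degree `≤ D` and OUTSIDE the gap `[G₁, G₂)`; the gap holds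
`≥ m₀` free coordinates; `LowDegIndep3At p (|W|·3^k·D) (1/(12·2^{|W|·3^k})) m₀` ⟹ `#WIN ≤ (1 − 4^{−(k+1)})·2ⁿ`,
every charge — the constant of §8, whatever `|W|`.  (Sum the conditioned count over the `2^{#gapX}` conditionings:
losers for different conditionings are different inputs.) -/
theorem multi_law_core (hP : PairsOK lo hi) (hlt : ∀ j, lo j < n ∧ hi j < n) (c : ℕ)
    (y : Fin (n + 1) → (Fin n → Bool) → Bool) (W : Finset (Fin (n + 1))) {G₁ G₂ : ℕ}
    (hW : ∀ g ∈ W, g.val ≤ G₁ ∨ G₂ ≤ g.val)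
    (hbl : ∀ g : Fin (n + 1), g ∉ W → ∃ j : Fin k, (lo j < g.val ↔ hi j < g.val) ∧
      ∀ u v : Fin n → Bool, (∀ i : Fin n, i.val ≠ lo j → i.val ≠ hi j → u i = v i) → y g u = y g v)
    {p : ℕ} [Fact p.Prime] {D m₀ : ℕ} (hdeg : ∀ g ∈ W, HasDegF p (y g) D)
    (hF : LowDegIndep3At p (W.card * 3 ^ k * D) (1 / (12 * 2 ^ (W.card * 3 ^ k))) m₀)
    (hm : m₀ ≤ (gapF lo hi G₁ G₂ (n := n)).card) :
    ((univ.filter fun u : Fin n → Bool => ringWinU c y u = true).card : ℝ) ≤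
      (1 - (1 / 4 : ℝ) ^ (k + 1)) * (2 : ℝ) ^ n := by
  classical
  set X := gapX lo hi G₁ G₂ (n := n) with hXdef
  set Fg := gapF lo hi G₁ G₂ (n := n) with hFdef
  set L := univ.filter fun u : Fin n → Bool => ringWinU c y u = false with hL
  -- sum over the conditionings `b : X → Bool`
  set π : (Fin n → Bool) → (↥X → Bool) := fun u i => u i.1 with hπ
  have hsplit : L.card = ∑ b : ↥X → Bool, (L.filter fun u => π u = b).card :=
    Finset.card_eq_sum_card_fiberwise (s := L) (t := univ) (f := π) fun _ _ => mem_univ _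
  have hper : ∀ b : ↥X → Bool, (2 : ℝ) ^ n / 4 / (2 : ℝ) ^ (Fgᶜ.card) ≤ ((L.filter fun u => π u = b).card : ℝ) := by
    intro b
    set a : Fin n → Bool := fun i => if h : i ∈ X then b ⟨i, h⟩ else false with ha
    refine (multi_cond hP hlt c y W hW hbl hdeg hF hm a).trans ?_
    have hsub : (univ.filter fun u : Fin n → Bool => ringWinU c y u = false ∧ ∀ i ∈ X, u i = a i) ⊆
        L.filter fun u => π u = b := by
      intro u hu
      rw [mem_filter] at hu
      refine mem_filter.2 ⟨mem_filter.2 ⟨mem_univ _, hu.2.1⟩, funext fun i => ?_⟩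
      rw [hπ]
      simp only
      rw [hu.2.2 i.1 i.2, ha]
      simp
    exact_mod_cast card_le_card hsub
  have hLge : (2 : ℝ) ^ (X.card) * ((2 : ℝ) ^ n / 4 / (2 : ℝ) ^ (Fgᶜ.card)) ≤ (L.card : ℝ) := by
    have h : ∑ b : ↥X → Bool, (2 : ℝ) ^ n / 4 / (2 : ℝ) ^ (Fgᶜ.card) ≤
        ∑ b : ↥X → Bool, ((L.filter fun u => π u = b).card : ℝ) := Finset.sum_le_sum fun b _ => hper b
    rw [Finset.sum_const, Finset.card_univ, Fintype.card_fun, Fintype.card_bool, Fintype.card_coe,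
      nsmul_eq_mul] at h
    have h' : (L.card : ℝ) = ∑ b : ↥X → Bool, ((L.filter fun u => π u = b).card : ℝ) := by exact_mod_cast hsplit
    rw [h']
    exact_mod_cast h
  -- `#gapFᶜ ≤ #X + 2k`, so the total is `≥ 2ⁿ/4/4^k`
  have hcomp : Fgᶜ.card ≤ X.card + 2 * k := card_compl_gapF_le
  have hpow : (2 : ℝ) ^ (Fgᶜ.card) ≤ (2 : ℝ) ^ (X.card) * (4 : ℝ) ^ k := by
    calc (2 : ℝ) ^ (Fgᶜ.card) ≤ (2 : ℝ) ^ (X.card + 2 * k) := pow_le_pow_right₀ (by norm_num) hcomp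
      _ = (2 : ℝ) ^ (X.card) * (4 : ℝ) ^ k := by rw [pow_add, pow_mul]; norm_num
  have h2X : (0 : ℝ) < (2 : ℝ) ^ (X.card) := by positivity
  have h2F : (0 : ℝ) < (2 : ℝ) ^ (Fgᶜ.card) := by positivity
  have h4pos : (0 : ℝ) < (4 : ℝ) ^ k := by positivity
  have h2n : (0 : ℝ) ≤ (2 : ℝ) ^ n := by positivity
  have hLge' : (2 : ℝ) ^ n / 4 / (4 : ℝ) ^ k ≤ (L.card : ℝ) := by
    refine le_trans ?_ hLge
    rw [div_le_iff₀ h4pos]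
    have : (2 : ℝ) ^ n / 4 / (4 : ℝ) ^ k * (4 : ℝ) ^ k = (2 : ℝ) ^ n / 4 := by field_simp
    calc (2 : ℝ) ^ n / 4 = (2 : ℝ) ^ (X.card) * ((2 : ℝ) ^ n / 4 / (2 : ℝ) ^ (Fgᶜ.card)) *
          ((2 : ℝ) ^ (Fgᶜ.card) / (2 : ℝ) ^ (X.card)) := by field_simp
      _ ≤ (2 : ℝ) ^ (X.card) * ((2 : ℝ) ^ n / 4 / (2 : ℝ) ^ (Fgᶜ.card)) * (4 : ℝ) ^ k := by
          refine mul_le_mul_of_nonneg_left ?_ (by positivity)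
          rw [div_le_iff₀ h2X]
          linarith
  -- conclude as in §8
  have htot : (univ.filter fun u : Fin n → Bool => ringWinU c y u = true).card + L.card = 2 ^ n := by
    have h := Finset.card_filter_add_card_filter_not
      (s := (univ : Finset (Fin n → Bool))) (fun u => ringWinU c y u = true)
    rw [Finset.card_univ, Fintype.card_fun, Fintype.card_bool, Fintype.card_fin] at h
    rw [← h, hL]
    congr 2
    ext u
    simp
  have htot' : ((univ.filter fun u : Fin n → Bool => ringWinU c y u = true).card : ℝ) + (L.card : ℝ) =
      (2 : ℝ) ^ n := by exact_mod_cast htot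
  have he : (1 - (1 / 4 : ℝ) ^ (k + 1)) * (2 : ℝ) ^ n = (2 : ℝ) ^ n - (2 : ℝ) ^ n / 4 / (4 : ℝ) ^ k := by
    rw [pow_succ, one_div_pow]
    field_simp
    try ring
  rw [he]
  linarith

end MultiDense

end Summit.QuantumAdvantage.QuantumAdvantage.Theorems.PartyDial
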